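import Literature.Probability.LatticeModels.MedialCycleSeparation
import HarnessLib

/-!
# The closed perturbed polygon of a cycle lies in the closed squares of its faces

Topic: `Summits/CriticalPhenomena/CardyFormulaZ2`. For the crux `LagHandOff` (line
hitting-tournament, touch criterion, stub B1): for a cycle of the turning rule `nextCorner β` of
period `n + 1` through the coded corner `q`, the range of the closed perturbed polygon
`cyLoop n h` (`MedialCycleSeparation.lean`) is contained in the union of the closed unit squares
`closedSq (cFace (cornerOrbit β q j))`, `j ≤ n`, of the faces of the cycle: dart pieces lie in
the open square of their face, face connectors in the closed square of the common face, and
vertex connectors in the union of the closed squares of the two faces across the crossed edge.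
-/

noncomputable section

open Set Complex Literature.Topology.PlaneTopology
open Literature.Probability.Percolation Literature.Probability.LatticeModels

namespace Summit.CriticalPhenomena.CardyFormulaZ2.Cruxes.LagHandOff.HittingTournament

/-- The closed square of the face of any orbit corner of index `m ≤ n + 1` is one of the closed
squares of the faces `0, …, n` of the cycle (the corner `n + 1` is the corner `0`). -/
theorem mem_iUnion_closedSq_of_mem_cyF {β : BondConfig (Site 2)} {q : Site 2 × Fin 4} {n : ℕ}
    (h : cornerOrbit β q (n + 1) = q) {m : ℕ} (hm : m ≤ n + 1) {z : ℂ}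
    (hz : z ∈ closedSq (cyF β q m)) :
    z ∈ ⋃ (j : ℕ) (_ : j ≤ n), closedSq (cFace (cornerOrbit β q j)) := by
  rcases Nat.lt_or_ge m (n + 1) with hlt | hge
  · exact mem_iUnion₂.2 ⟨m, Nat.lt_succ_iff.1 hlt, hz⟩
  · have hm' : m = n + 1 := le_antisymm hm hge
    subst hm'
    refine mem_iUnion₂.2 ⟨0, Nat.zero_le _, ?_⟩
    have hF : cyF β q (n + 1) = cFace (cornerOrbit β q 0) := by
      rw [cyF, h]; rfl
    rwa [hF] at hz

/-- A dart piece of the cycle lies in the closed square of its face. -/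
theorem cyDart_subset_closedSq {β : BondConfig (Site 2)} {q : Site 2 × Fin 4} (m : ℕ) :
    cyDart β q m ⊆ closedSq (cyF β q m) := by
  intro z hz k
  rw [cyDart_eq] at hz
  obtain ⟨h1, h2⟩ := dartSeg_subset_openSq (isCorner_cy m) hz k
  exact ⟨h1.le, h2.le⟩

/-- A connector of the cycle lies in the closed square of the face before it or of the face
after it. -/
theorem cyConn_subset_closedSq_union {β : BondConfig (Site 2)} {q : Site 2 × Fin 4} (m : ℕ) :
    cyConn β q m ⊆ closedSq (cyF β q m) ∪ closedSq (cyF β q (m + 1)) := by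
  intro z hz
  rcases cyConn_cases m hz with ⟨I, J, hJI, -, -, hcol, hside, -, hshape⟩ | ⟨I, J, hJI, -, hshape⟩
  · -- vertex turn: column `a = cyF m I = cyF (m+1) I`, coordinate `J` within `1/8` of `g`
    obtain ⟨-, hzi, hzj1, hzj2⟩ := hshape
    have hI : ∀ a : ℤ, a = cyF β q m I →
        (a : ℝ) ≤ coordVec z I ∧ coordVec z I ≤ a + 1 := by
      rintro a rfl
      rcases hzi with h' | h' <;> constructor <;> linarith
    rcases le_total (coordVec z J) (cyV β q m J) with hle | hge
    · -- below the line `x_J = g`: the face with `f J + 1 = g`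
      rcases hside with ⟨h1, h2⟩ | ⟨h1, h2⟩
      · left
        intro k
        rcases fin_two_cases_of_ne hJI k with rfl | rfl
        · exact hI _ rfl
        · have h1' : ((cyF β q m k : ℤ) : ℝ) + 1 = cyV β q m k := by exact_mod_cast h1
          constructor <;> linarith
      · right
        intro k
        rcases fin_two_cases_of_ne hJI k with rfl | rfl
        · rw [← hcol]; exact hI _ rfl
        · have h2' : ((cyF β q (m + 1) k : ℤ) : ℝ) + 1 = cyV β q m k := by exact_mod_cast h2
          constructor <;> linarith
    · -- above the line `x_J = g`: the face with `f J = g`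
      rcases hside with ⟨h1, h2⟩ | ⟨h1, h2⟩
      · right
        intro k
        rcases fin_two_cases_of_ne hJI k with rfl | rfl
        · rw [← hcol]; exact hI _ rfl
        · have h2' : ((cyF β q (m + 1) k : ℤ) : ℝ) = cyV β q m k := by exact_mod_cast h2
          constructor <;> linarith
      · left
        intro k
        rcases fin_two_cases_of_ne hJI k with rfl | rfl
        · exact hI _ rfl
        · have h1' : ((cyF β q m k : ℤ) : ℝ) = cyV β q m k := by exact_mod_cast h1
          constructor <;> linarith
  · -- face turn: inside the common face
    obtain ⟨-, ⟨hzi1, hzi2⟩, hzj⟩ := hshape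
    left
    intro k
    rcases fin_two_cases_of_ne hJI k with rfl | rfl
    · constructor <;> linarith
    · rcases hzj with h' | h' <;> constructor <;> linarith

/-- **B1: the closed perturbed polygon of a cycle lies in the closed squares of its faces.**
For a cycle of the turning rule of period `n + 1` through `q`, every point of `cyLoop n h` lies
in `closedSq (cFace (cornerOrbit β q j))` for some `j ≤ n`. -/
theorem stub_touch_range_cyLoop_subset_closedSq :
    ∀ (β : BondConfig (Site 2)) (q : Site 2 × Fin 4) (n : ℕ) (h : cornerOrbit β q (n + 1) = q),
      range (cyLoop n h) ⊆ ⋃ (j : ℕ) (_ : j ≤ n), closedSq (cFace (cornerOrbit β q j)) := by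
  intro β q n h z hz
  rcases range_cyLoop_subset n h hz with h' | h'
  · obtain ⟨j, hj, h'⟩ := mem_iUnion₂.1 h'
    exact mem_iUnion_closedSq_of_mem_cyF h (Nat.le_succ_of_le hj) (cyDart_subset_closedSq j h')
  · obtain ⟨j, hj, h'⟩ := mem_iUnion₂.1 h'
    rcases cyConn_subset_closedSq_union j h' with h'' | h''
    · exact mem_iUnion_closedSq_of_mem_cyF h (Nat.le_succ_of_le hj) h''
    · exact mem_iUnion_closedSq_of_mem_cyF h (Nat.succ_le_succ hj) h''

end Summit.CriticalPhenomena.CardyFormulaZ2.Cruxes.LagHandOff.HittingTournament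

end
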